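import Literature.Analysis.PDE.LoewnerNirenbergMaximal
import Mathlib.Analysis.InnerProductSpace.Convex
import Mathlib.Analysis.InnerProductSpace.Dual
import Mathlib.Analysis.Calculus.MeanValue
import Mathlib.Analysis.Normed.Module.Convex
import Mathlib.Analysis.Normed.Module.RCLike.Real
import Mathlib.Analysis.Convex.StrictConvexSpace
import Mathlib.Analysis.Convex.SpecificFunctions.Basic
import Mathlib.Analysis.Normed.Module.Ball.Pointwise
import Mathlib.Analysis.Normed.Module.Ray
import Mathlib.Topology.Connected.Clopen
import HarnessLib

/-!
# Loewner–Nirenberg theory: the boundary asymptotics `|d^{(n-2)/2} u - 1| ≤ C d` (F3), proved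

This file DISCHARGES the named fact `LoewnerNirenberg.boundary_asymptotics` of
`LoewnerNirenbergFacts.lean` (F3 there; Loewner–Nirenberg 1974, restated in Han–Shen 2020, (1.3),
and proved there as Thm. 3.1 with `α = 1`) as `LoewnerNirenberg.boundary_asymptotics_holds`,
following the published proof (Han–Shen 2020, proof of Thm. 3.1, case `α = 1`, p. 7 of
arXiv:1511.01146): for `x ∈ Ω` near `∂Ω` with nearest boundary point `p`, `d = d(x) = |x - p|`,
place an interior tangent ball `B_r(c) ⊆ Ω` and an exterior tangent ball `B_r(c')`,
`B_r(c') ∩ Ω = ∅`, at `p` (uniform `r`: `∂Ω` is `C²` and compact); "by the maximum principle"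
`v_{r,c'} ≤ u ≤ u_{r,c}` (the ball profile (2.1) and the exterior profile (2.2)), and since `x`,
`p`, `c`, `c'` are collinear with `|x - c| = r - d`, `|x - c'| = r + d`,
`d^{-(n-2)/2}(1 + d/2r)^{-(n-2)/2} ≤ u(x) ≤ d^{-(n-2)/2}(1 - d/2r)^{-(n-2)/2}`, whence
`|d^{(n-2)/2}u - 1| ≤ C d` for `d < r`.

## Contents (all proved; no named fact and no `sorry` is introduced)

* the two comparisons "by the maximum principle": `u ≤ u_{r,c}` on an interior tangent ball
  `B_r(c) ⊆ Ω` (inside `boundary_asymptotics_holds`: the closed-ball comparison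
  `IsSubsolution.le_ballProfile` of `LoewnerNirenbergMaximal.lean`, González–Li–Nguyen 2018,
  Lemma 3.1, on `B̄_σ(c)`, `σ < r`, and `σ → r`); `exteriorProfile_le_of_isLargeSolution` —
  `v_{r,c'} ≤ u` on `Ω` for a large solution `u` of a bounded open `Ω` disjoint from the OPEN
  ball `B_r(c')` (comparison with `v_{σ,c'}`, `σ < r`, a solution on a neighbourhood of `Ω̄`, by
  the comparison principle `IsLargeSolution.ge_of_isSolution` of `LoewnerNirenbergMaximal.lean`,
  González–Li–Nguyen 2018, Prop. 2.2, and `σ → r`);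
* `exists_uniform_twoSided_ball` — **uniform two-sided tangent balls** for a bounded domain with
  `C²` boundary (`IsContDiffDomain 2`): there is `r > 0` such that every `p ∈ ∂Ω` has
  `B_r(c) ⊆ Ω` and `B_r(c') ∩ Ω = ∅` with `|p - c| = |p - c'| = r` (second-order Taylor estimate
  of the local defining function `φ(y) = ⟪y,u⟫ - γ(y - ⟪y,u⟫u)`,
  `exists_twoSided_ball_of_isContDiffGraphNear`, and compactness of `∂Ω`);
* `ball_infDist_frontier_subset`, `norm_sub_center_eq_of_tangent_balls` — `B_{d(x)}(x) ⊆ Ω`, and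
  the collinearity `|x - c| = r - d`, `|x - c'| = r + d` (equality in the triangle inequality in
  a strictly convex space);
* `one_sub_rpow_le_max_mul` — `1 - s^k ≤ max(k,1)(1 - s)` on `(0,1]`;
* `boundary_asymptotics_holds`, with `δ = r` and `C = max(k,1) 2^k / (2r)`, `k = (n-2)/2`.

## References

* Q. Han, W. Shen, *The Loewner–Nirenberg problem in singular domains*, J. Funct. Anal. 279
  (2020) 108604, doi:10.1016/j.jfa.2020.108604, arXiv:1511.01146: (1.3), (2.1), (2.2), Thm. 3.1
  and its proof (case `α = 1`, p. 7). [HanShen2020]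
* C. Loewner, L. Nirenberg, *Partial differential equations invariant under conformal or
  projective transformations*, Contributions to Analysis, Academic Press (1974), 245–272, Thm. 4.
  [LoewnerNirenberg1974]
* M. d. M. González, Y. Y. Li, L. Nguyen, *Existence and uniqueness to a fully nonlinear version
  of the Loewner–Nirenberg problem*, Commun. Math. Stat. 6 (2018) 269–288, arXiv:1804.08851:
  Prop. 2.2, Lemma 3.1. [GonzalezLiNguyen2018]
-/

noncomputable section

open Set Filter Metric Module TopologicalSpace Bornology
open scoped Laplacian Topology ContDiff RealInnerProductSpace

namespace Literature.Analysis.PDE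

namespace LoewnerNirenberg

open Literature.Analysis.FunctionSpaces (IsContDiffDomain IsContDiffGraphNear)

variable {E : Type*} [NormedAddCommGroup E] [InnerProductSpace ℝ E] [FiniteDimensional ℝ E]

/-! ### Comparison with the exterior profile of a tangent ball -/

omit [FiniteDimensional ℝ E] in
/-- The exterior profile `v_{σ,c}(x)` is continuous in the radius `σ` at `σ = ρ < ‖x - c‖`.
[folklore] -/
theorem continuousAt_exteriorProfile_radius (c x : E) {ρ : ℝ} (hρ : 0 < ρ) (hx : ρ < ‖x - c‖) :
    ContinuousAt (fun σ : ℝ => exteriorProfile c σ x) ρ := by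
  have hlt : ρ ^ 2 < ‖x - c‖ ^ 2 := pow_lt_pow_left₀ hx hρ.le two_ne_zero
  have hden : ‖x - c‖ ^ 2 - ρ ^ 2 ≠ 0 := by linarith
  unfold exteriorProfile
  refine ContinuousAt.rpow_const ?_ (Or.inl ?_)
  · exact (continuousAt_const.mul continuousAt_id).div
      (continuousAt_const.sub (continuousAt_id.pow 2)) hden
  · exact (div_pos (by linarith) (by linarith)).ne'

/-- **The exterior profile of an exterior tangent ball lies below every large solution**: if `Ω`
is bounded and open, `B_ρ(c) ∩ Ω = ∅` (the closures may touch), and `u` is a large solution on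
`Ω`, then `v_{ρ,c} ≤ u` on `Ω` ("by the maximum principle, we have `u ≥ v_{r,-re_n}` in `Ω`",
Han–Shen 2020, proof of Thm. 3.1): compare `u` with `v_{σ,c}`, `σ < ρ`, a solution on the open
neighbourhood `ℝⁿ ∖ B̄_σ(c)` of `Ω̄` (comparison principle, González–Li–Nguyen 2018, Prop. 2.2, as
`IsLargeSolution.ge_of_isSolution`), and let `σ → ρ`.
[cite: HanShen2020, (2.2) and proof of Thm. 3.1] -/
theorem exteriorProfile_le_of_isLargeSolution (hn : 3 ≤ finrank ℝ E) {Ω : Set E} (hΩ : IsOpen Ω)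
    (hb : IsBounded Ω) {u : E → ℝ} (hu : IsLargeSolution Ω u) {c : E} {ρ : ℝ} (hρ : 0 < ρ)
    (hdisj : Disjoint (ball c ρ) Ω) {x : E} (hx : x ∈ Ω) : exteriorProfile c ρ x ≤ u x := by
  have hΩsub : Ω ⊆ (ball c ρ)ᶜ := hdisj.symm.subset_compl_right
  have hcl : closure Ω ⊆ (ball c ρ)ᶜ := closure_minimal hΩsub isOpen_ball.isClosed_compl
  have hxc : ρ < ‖x - c‖ := by
    have h1 : Ω ⊆ interior (ball c ρ)ᶜ := hΩ.subset_interior_iff.2 hΩsub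
    have h2 := h1 hx
    rw [interior_compl, closure_ball c hρ.ne', mem_compl_iff, mem_closedBall, not_le,
      dist_eq_norm] at h2
    exact h2
  -- `σ < ρ`: `v_{σ,c}` is a solution on the open set `ℝⁿ ∖ B̄_σ(c) ⊇ Ω̄`, hence below the large
  -- solution `u` (the comparison principle `IsLargeSolution.ge_of_isSolution`)
  have hev : ∀ᶠ σ in 𝓝[<] ρ, exteriorProfile c σ x ≤ u x := by
    filter_upwards [Ioo_mem_nhdsLT hρ] with σ hσ
    have h1 : (ball c ρ)ᶜ ⊆ (closedBall c σ)ᶜ := compl_subset_compl.2 (closedBall_subset_ball hσ.2)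
    exact hu.ge_of_isSolution hn hΩ hb isClosed_closedBall.isOpen_compl (hcl.trans h1)
      (isSolution_exteriorProfile c hσ.1) x hx
  exact le_of_tendsto
    ((continuousAt_exteriorProfile_radius c x hρ hxc).tendsto.mono_left nhdsWithin_le_nhds) hev

/-! ### Distance to the boundary: the interior ball `B_{d(x)}(x)` and collinearity -/

omit [InnerProductSpace ℝ E] [FiniteDimensional ℝ E] in
/-- For `x` in an open `Ω`, the ball of radius `d(x) = dist(x, ∂Ω)` about `x` lies in `Ω` (it is
connected, meets `Ω`, and misses `∂Ω`) (Han–Shen 2020, proof of Lemma 3.2: "`B_{d(x)}(x) ⊆ Ω`").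
[cite: HanShen2020, proof of Lemma 3.2] -/
theorem ball_infDist_frontier_subset [NormedSpace ℝ E] {Ω : Set E} (hΩ : IsOpen Ω) {x : E}
    (hx : x ∈ Ω) : ball x (infDist x (frontier Ω)) ⊆ Ω := by
  rcases le_or_gt (infDist x (frontier Ω)) 0 with h0 | h0
  · rw [Metric.ball_eq_empty.2 h0]
    exact empty_subset _
  refine (convex_ball x _).isPreconnected.subset_of_closure_inter_subset hΩ
    ⟨x, mem_ball_self h0, hx⟩ ?_
  rintro y ⟨hyc, hyb⟩
  have hyf : y ∉ frontier Ω := ball_infDist_subset_compl hyb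
  have : y ∈ closure Ω \ frontier Ω := ⟨hyc, hyf⟩
  rwa [closure_sdiff_frontier, hΩ.interior_eq] at this

omit [FiniteDimensional ℝ E] in
/-- Equality in the triangle inequality in an inner product space: `‖a + b‖ = ‖a‖ + ‖b‖` forces
`‖a‖ • b = ‖b‖ • a` (strict convexity). [folklore] -/
theorem norm_smul_eq_of_norm_add_eq {a b : E} (h : ‖a + b‖ = ‖a‖ + ‖b‖) : ‖a‖ • b = ‖b‖ • a :=
  (sameRay_iff_norm_add.2 h).norm_smul_eq

omit [FiniteDimensional ℝ E] in
/-- **Collinearity of `x`, `p`, `c`, `c'`.** Let `B_d(x) ⊆ Ω`, `B_ρ(c) ⊆ Ω`, `B_ρ(c') ∩ Ω = ∅`,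
with `‖x - p‖ = d`, `‖c - p‖ = ‖c' - p‖ = ρ` (`p` a common boundary point), `0 < d ≤ ρ`. Then
`‖x - c'‖ = ρ + d` and `‖x - c‖ = ρ - d`: the balls `B_d(x)`, `B_ρ(c)` are disjoint from
`B_ρ(c')`, so `‖x - c'‖ ≥ d + ρ` and `‖c - c'‖ ≥ 2ρ`, with equality by the triangle inequality
through `p`; equality in the triangle inequality makes `p - x`, `p - c` positive multiples of
`c' - p` (Han–Shen 2020, proof of Thm. 3.1: "`x` is on the positive `x_n`-axis"). [folklore] -/
theorem norm_sub_center_eq_of_tangent_balls {Ω : Set E} {x p c c' : E} {d ρ : ℝ} (hd : 0 < d)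
    (hρ : 0 < ρ) (hdρ : d ≤ ρ) (hxΩ : ball x d ⊆ Ω) (hcΩ : ball c ρ ⊆ Ω)
    (hc' : Disjoint (ball c' ρ) Ω) (hxp : ‖x - p‖ = d) (hcp : ‖c - p‖ = ρ) (hc'p : ‖c' - p‖ = ρ) :
    ‖x - c'‖ = ρ + d ∧ ‖x - c‖ = ρ - d := by
  -- `‖x - c'‖ = d + ρ`
  have h1 : d + ρ ≤ ‖x - c'‖ := by
    rw [← dist_eq_norm]
    exact (disjoint_ball_ball_iff hd hρ).1 (hc'.symm.mono_left hxΩ)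
  have h1' : ‖x - c'‖ ≤ d + ρ := by
    calc ‖x - c'‖ = ‖(p - x) + (c' - p)‖ := by
          rw [← norm_neg]; congr 1; abel
      _ ≤ ‖p - x‖ + ‖c' - p‖ := norm_add_le _ _
      _ = d + ρ := by rw [norm_sub_rev, hxp, hc'p]
  have hxc' : ‖x - c'‖ = d + ρ := le_antisymm h1' h1
  -- `‖c - c'‖ = 2ρ`
  have h2 : ρ + ρ ≤ ‖c - c'‖ := by
    rw [← dist_eq_norm]
    exact (disjoint_ball_ball_iff hρ hρ).1 (hc'.symm.mono_left hcΩ)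
  have h2' : ‖c - c'‖ ≤ ρ + ρ := by
    calc ‖c - c'‖ = ‖(p - c) + (c' - p)‖ := by
          rw [← norm_neg]; congr 1; abel
      _ ≤ ‖p - c‖ + ‖c' - p‖ := norm_add_le _ _
      _ = ρ + ρ := by rw [norm_sub_rev, hcp, hc'p]
  have hcc' : ‖c - c'‖ = ρ + ρ := le_antisymm h2' h2
  -- equality cases
  have e1 : ‖(p - x) + (c' - p)‖ = ‖p - x‖ + ‖c' - p‖ := by
    rw [norm_sub_rev p x, hxp, hc'p, ← hxc', ← norm_neg]
    congr 1; abel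
  have e2 : ‖(p - c) + (c' - p)‖ = ‖p - c‖ + ‖c' - p‖ := by
    rw [norm_sub_rev p c, hcp, hc'p, ← hcc', ← norm_neg]
    congr 1; abel
  have s1 := norm_smul_eq_of_norm_add_eq e1
  have s2 := norm_smul_eq_of_norm_add_eq e2
  rw [norm_sub_rev p x, hxp, hc'p] at s1
  rw [norm_sub_rev p c, hcp, hc'p] at s2
  -- `s1 : d • (c' - p) = ρ • (p - x)`, `s2 : ρ • (c' - p) = ρ • (p - c)`
  have s2' : c' - p = p - c := smul_right_injective E hρ.ne' s2
  refine ⟨by rw [hxc', add_comm], ?_⟩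
  have key : ρ • (x - c) = (ρ - d) • (c' - p) := by
    have : ρ • (x - c) = ρ • (p - c) - ρ • (p - x) := by
      rw [← smul_sub]; congr 1; abel
    rw [this, ← s1, ← s2', sub_smul]
  have hn := congrArg norm key
  rw [norm_smul, norm_smul, hc'p, Real.norm_of_nonneg hρ.le, Real.norm_of_nonneg (by linarith),
    mul_comm (ρ - d) ρ] at hn
  exact mul_left_cancel₀ hρ.ne' hn

/-! ### An elementary power estimate -/

/-- For `0 < s ≤ 1` and real `k`: `1 - s^k ≤ max(k, 1) (1 - s)` (Bernoulli for `k ≥ 1`;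
`s^k ≥ s` for `k ≤ 1`). [folklore] -/
theorem one_sub_rpow_le_max_mul {s : ℝ} (k : ℝ) (hs0 : 0 < s) (hs1 : s ≤ 1) :
    1 - s ^ k ≤ max k 1 * (1 - s) := by
  rcases le_or_gt 1 k with hk1 | hk1
  · -- Bernoulli: `1 + k (s - 1) ≤ (1 + (s - 1))^k = s^k`
    have hB := one_add_mul_self_le_rpow_one_add (s := s - 1) (by linarith) hk1
    rw [show 1 + (s - 1) = s by ring] at hB
    have : k * (1 - s) ≤ max k 1 * (1 - s) :=
      mul_le_mul_of_nonneg_right (le_max_left _ _) (by linarith)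
    linarith
  · have h1 : s ^ (1 : ℝ) ≤ s ^ k := Real.rpow_le_rpow_of_exponent_ge hs0 hs1 hk1.le
    rw [Real.rpow_one] at h1
    have : 1 * (1 - s) ≤ max k 1 * (1 - s) :=
      mul_le_mul_of_nonneg_right (le_max_right _ _) (by linarith)
    linarith

/-! ### Uniform two-sided tangent balls for bounded `C²` domains -/

/-- A finite family of positive reals has a positive lower bound. [folklore] -/
theorem exists_pos_le_of_finite {ι : Type*} {s : Set ι} (hs : s.Finite) (f : ι → ℝ)
    (hf : ∀ i ∈ s, 0 < f i) : ∃ ρ > 0, ∀ i ∈ s, ρ ≤ f i := by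
  classical
  by_cases hne : hs.toFinset.Nonempty
  · refine ⟨hs.toFinset.inf' hne f, ?_, fun i hi => Finset.inf'_le f (hs.mem_toFinset.2 hi)⟩
    rw [gt_iff_lt, Finset.lt_inf'_iff]
    exact fun i hi => hf i (hs.mem_toFinset.1 hi)
  · exact ⟨1, one_pos, fun i hi => (hne ⟨i, hs.mem_toFinset.2 hi⟩).elim⟩

/-- **Two-sided tangent balls along a `C²` graph, locally with a uniform radius.** If inside
`B(x₀, r)` the open set `Ω` is the strict epigraph `{γ(y - ⟪y,u⟫u) < ⟪y,u⟫}` of a `C²` function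
(`IsContDiffGraphNear 2 Ω x₀ r`), then there is `ρ₀ > 0` such that for every `0 < ρ ≤ ρ₀` and every
boundary point `p ∈ ∂Ω ∩ B(x₀, r/2)` the balls `B_ρ(p ± ρ ν(p))`, `ν(p) = ∇φ(p)/|∇φ(p)|`,
`φ(y) = ⟪y,u⟫ - γ(y - ⟪y,u⟫u)`, satisfy `B_ρ(p + ρν) ⊆ Ω` and `B_ρ(p - ρν) ∩ Ω = ∅`: with
`|D²φ| ≤ K` on `B̄(x₀, r)` one has `|φ(y) - φ(p) - Dφ(p)(y - p)| ≤ K|y - p|²`, `φ(p) = 0`,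
`Dφ(p)u = 1`, and `|y - (p ± ρν)| < ρ` forces `±Dφ(p)(y - p) > |∇φ(p)| |y - p|²/(2ρ)`, so `±φ(y) > 0`
once `2ρK ≤ 1` (the interior/exterior tangent balls of a `C^{1,1}` boundary, Han–Shen 2020, §1:
"if the domain `Ω` is `C^{1,1}`, we can place an interior tangent ball and an exterior tangent ball
at each of the boundary point"). [cite: HanShen2020, §1 and proof of Thm. 3.1] -/
theorem exists_twoSided_ball_of_isContDiffGraphNear {Ω : Opens E} {x₀ : E} {r : ℝ}
    (h : IsContDiffGraphNear 2 Ω x₀ r) (hr : 0 < r) :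
    ∃ ρ₀ > 0, ∀ ρ, 0 < ρ → ρ ≤ ρ₀ → ∀ p ∈ frontier (Ω : Set E) ∩ ball x₀ (r / 2),
      (∃ c, ball c ρ ⊆ (Ω : Set E) ∧ ‖c - p‖ = ρ) ∧
      (∃ c', Disjoint (ball c' ρ) (Ω : Set E) ∧ ‖c' - p‖ = ρ) := by
  obtain ⟨u, hu, γ, hγ, hchart⟩ := h
  -- the projection `P y = y - ⟪y,u⟫ u` and the defining function `φ y = ⟪y,u⟫ - γ (P y)`
  set L : E →L[ℝ] ℝ := innerSL ℝ u with hL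
  set P : E →L[ℝ] E := ContinuousLinearMap.id ℝ E - L.smulRight u with hP
  have hLy : ∀ y, L y = ⟪y, u⟫ := fun y => by simp [hL, real_inner_comm]
  have hPy : ∀ y, P y = y - ⟪y, u⟫ • u := fun y => by simp [hP, hLy]
  have huu : ⟪u, u⟫ = 1 := by rw [real_inner_self_eq_norm_sq, hu, one_pow]
  have hPu : P u = 0 := by rw [hPy, huu, one_smul, sub_self]
  set φ : E → ℝ := fun y => L y - γ (P y) with hφdef
  have hφ : ContDiff ℝ 2 φ := L.contDiff.sub (hγ.comp P.contDiff)
  -- the chart: inside `B(x₀, r)`, `Ω = {0 < φ}`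
  have hmem : ∀ y ∈ ball x₀ r, (y ∈ (Ω : Set E) ↔ 0 < φ y) := by
    intro y hy
    constructor
    · intro hyΩ
      have hy' : y ∈ (Ω : Set E) ∩ ball x₀ r := ⟨hyΩ, hy⟩
      rw [hchart] at hy'
      show 0 < L y - γ (P y)
      rw [hLy, hPy]
      exact sub_pos.2 hy'.2
    · intro hφy
      have h1 : 0 < L y - γ (P y) := hφy
      rw [hLy, hPy] at h1
      have hy' : y ∈ {y | y ∈ ball x₀ r ∧ γ (y - ⟪y, u⟫ • u) < ⟪y, u⟫} := ⟨hy, sub_pos.1 h1⟩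
      rw [← hchart] at hy'
      exact hy'.1
  -- the derivative of `φ`; `Dφ(q) u = 1`, so `‖Dφ(q)‖ ≥ 1`
  have hφd : ∀ q, HasFDerivAt φ (L - (fderiv ℝ γ (P q)).comp P) q := fun q =>
    L.hasFDerivAt.sub (((hγ.differentiable two_ne_zero) (P q)).hasFDerivAt.comp q P.hasFDerivAt)
  have hφ'u : ∀ q, fderiv ℝ φ q u = 1 := by
    intro q
    rw [(hφd q).fderiv]
    simp [hPu, hLy, hu]
  have hφ'norm : ∀ q, 1 ≤ ‖fderiv ℝ φ q‖ := by
    intro q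
    have := (fderiv ℝ φ q).le_opNorm u
    rwa [hφ'u q, hu, mul_one, Real.norm_eq_abs, abs_one] at this
  -- a bound `K₁` for the Hessian on `B̄(x₀, r)`; `Dφ` is `K₁`-Lipschitz on `B(x₀, r)`
  have hφ1 : ContDiff ℝ 1 (fderiv ℝ φ) := hφ.fderiv_right (m := 1) le_rfl
  obtain ⟨K, hK⟩ := (isCompact_closedBall x₀ r).exists_bound_of_continuousOn
    ((hφ1.continuous_fderiv one_ne_zero).continuousOn)
  set K₁ : ℝ := max K 0 + 1 with hK₁
  have hK₁0 : 0 < K₁ := by rw [hK₁]; positivity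
  have hKK₁ : K ≤ K₁ := by rw [hK₁]; linarith [le_max_left K 0]
  have hDφ : ∀ z ∈ ball x₀ r, ∀ q ∈ ball x₀ r,
      ‖fderiv ℝ φ z - fderiv ℝ φ q‖ ≤ K₁ * ‖z - q‖ := fun z hz q hq =>
    (convex_ball x₀ r).norm_image_sub_le_of_norm_fderiv_le
      (fun y _ => hφ1.differentiable one_ne_zero y)
      (fun y hy => (hK y (ball_subset_closedBall hy)).trans hKK₁) hq hz
  -- the second-order Taylor estimate `|φ y - φ q - Dφ(q)(y - q)| ≤ K₁ ‖y - q‖²`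
  have hT : ∀ q ∈ ball x₀ r, ∀ y ∈ ball x₀ r,
      ‖φ y - φ q - fderiv ℝ φ q (y - q)‖ ≤ K₁ * ‖y - q‖ * ‖y - q‖ := by
    intro q hq y hy
    have hconv : Convex ℝ (ball x₀ r ∩ closedBall q ‖y - q‖) :=
      (convex_ball _ _).inter (convex_closedBall _ _)
    refine hconv.norm_image_sub_le_of_norm_fderiv_le'
      (fun z _ => hφ.differentiable two_ne_zero z) ?_
      ⟨hq, mem_closedBall_self (norm_nonneg _)⟩ ⟨hy, by rw [mem_closedBall, dist_eq_norm]⟩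
    intro z hz
    calc ‖fderiv ℝ φ z - fderiv ℝ φ q‖ ≤ K₁ * ‖z - q‖ := hDφ z hz.1 q hq
      _ ≤ K₁ * ‖y - q‖ := by
          refine mul_le_mul_of_nonneg_left ?_ hK₁0.le
          rw [← dist_eq_norm]
          exact hz.2
  -- boundary points in the chart are zeros of `φ`
  have hφq : ∀ q ∈ frontier (Ω : Set E), q ∈ ball x₀ r → φ q = 0 := by
    intro q hq hqb
    have hqΩ : q ∉ (Ω : Set E) := by
      have hq' := hq
      rw [Ω.isOpen.frontier_eq] at hq'
      exact hq'.2
    rcases lt_trichotomy (φ q) 0 with hlt | heq | hgt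
    · exfalso
      have hopen : IsOpen ({y | φ y < 0} ∩ ball x₀ r) :=
        (isOpen_lt hφ.continuous continuous_const).inter isOpen_ball
      obtain ⟨y, ⟨hy1, hy2⟩, hyΩ⟩ :=
        mem_closure_iff.1 (frontier_subset_closure hq) _ hopen ⟨hlt, hqb⟩
      have h1 := (hmem y hy2).1 hyΩ
      have h2 : φ y < 0 := hy1
      linarith
    · exact heq
    · exact absurd ((hmem q hqb).2 hgt) hqΩ
  -- the radius
  refine ⟨min (r / 4) (1 / (2 * K₁)), lt_min (by positivity) (by positivity), ?_⟩
  rintro ρ hρ hρle p ⟨hp, hpx⟩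
  have hρr : ρ ≤ r / 4 := hρle.trans (min_le_left _ _)
  have hρK : ρ * (2 * K₁) ≤ 1 := (le_div_iff₀ (by positivity)).1 (hρle.trans (min_le_right _ _))
  have hpb : p ∈ ball x₀ r := ball_subset_ball (by linarith) hpx
  have hpx' : dist p x₀ < r / 2 := hpx
  have hφp : φ p = 0 := hφq p hp hpb
  -- the unit normal `ν = ∇φ(p)/‖∇φ(p)‖`
  set N : E := (InnerProductSpace.toDual ℝ E).symm (fderiv ℝ φ p) with hN
  have hNnorm : ‖N‖ = ‖fderiv ℝ φ p‖ := (InnerProductSpace.toDual ℝ E).symm.norm_map _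
  have hm1 : 1 ≤ ‖N‖ := hNnorm ▸ hφ'norm p
  have hm0 : 0 < ‖N‖ := one_pos.trans_le hm1
  have hN0 : N ≠ 0 := norm_pos_iff.1 hm0
  have hNin : ∀ w, ⟪w, N⟫ = fderiv ℝ φ p w := fun w => by
    rw [real_inner_comm, hN, InnerProductSpace.toDual_symm_apply]
  set ν : E := ‖N‖⁻¹ • N with hν
  have hν1 : ‖ν‖ = 1 := norm_smul_inv_norm hN0
  have hρν : ‖ρ • ν‖ = ρ := by rw [norm_smul, hν1, mul_one, Real.norm_of_nonneg hρ.le]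
  have hνin : ∀ w, ⟪w, ρ • ν⟫ = ρ * (‖N‖⁻¹ * fderiv ℝ φ p w) := fun w => by
    rw [real_inner_smul_right, hν, real_inner_smul_right, hNin]
  -- points of `B_ρ(p ± ρν)` lie in the chart ball
  have hchartball : ∀ {c y : E}, ‖c - p‖ = ρ → dist y c < ρ → y ∈ ball x₀ r := by
    intro c y hc hy
    rw [mem_ball]
    calc dist y x₀ ≤ dist y c + dist c p + dist p x₀ := dist_triangle4 _ _ _ _
      _ < ρ + ρ + r / 2 := by
          rw [dist_eq_norm c p, hc]
          linarith
      _ ≤ r := by linarith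
  -- the Taylor estimate at `p`, in terms of `a = Dφ(p)(y - p)` and `W = ‖y - p‖²`
  have hTp : ∀ y ∈ ball x₀ r, |φ y - fderiv ℝ φ p (y - p)| ≤ K₁ * ‖y - p‖ ^ 2 := by
    intro y hyb
    have h4 := hT p hpb y hyb
    rwa [hφp, sub_zero, Real.norm_eq_abs, mul_assoc, ← pow_two] at h4
  constructor
  · -- the interior ball `B_ρ(p + ρν) ⊆ Ω`
    refine ⟨p + ρ • ν, fun y hy => ?_, by rw [add_sub_cancel_left, hρν]⟩
    have hyc : dist y (p + ρ • ν) < ρ := hy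
    have hyb : y ∈ ball x₀ r := hchartball (by rw [add_sub_cancel_left, hρν]) hyc
    refine (hmem y hyb).2 ?_
    have hW0 : 0 ≤ ‖y - p‖ ^ 2 := by positivity
    -- `‖(y - p) - ρν‖ < ρ` gives `‖y - p‖² < 2ρ ⟪y - p, ν⟫`
    have hlt : ‖y - p‖ ^ 2 - 2 * (ρ * (‖N‖⁻¹ * fderiv ℝ φ p (y - p))) + ρ ^ 2 < ρ ^ 2 := by
      have h1 : ‖(y - p) - ρ • ν‖ < ρ := by
        rwa [sub_sub, ← dist_eq_norm]
      have h2 : ‖(y - p) - ρ • ν‖ ^ 2 < ρ ^ 2 := pow_lt_pow_left₀ h1 (norm_nonneg _) two_ne_zero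
      rwa [norm_sub_sq_real, hνin, hρν] at h2
    have h1 : ‖y - p‖ ^ 2 < 2 * ρ * (‖N‖⁻¹ * fderiv ℝ φ p (y - p)) := by linarith
    have h2 : ‖N‖ * ‖y - p‖ ^ 2 < 2 * ρ * fderiv ℝ φ p (y - p) := by
      have := mul_lt_mul_of_pos_left h1 hm0
      rwa [show ‖N‖ * (2 * ρ * (‖N‖⁻¹ * fderiv ℝ φ p (y - p))) = 2 * ρ * fderiv ℝ φ p (y - p) by
        field_simp] at this
    have h3 : ‖y - p‖ ^ 2 ≤ ‖N‖ * ‖y - p‖ ^ 2 := le_mul_of_one_le_left hW0 hm1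
    -- Taylor: `φ y ≥ a - K₁ W`
    have h4 := (abs_le.1 (hTp y hyb)).1
    have h5 : 0 ≤ (1 - ρ * (2 * K₁)) * ‖y - p‖ ^ 2 := mul_nonneg (by linarith) hW0
    have h6 : 0 < 2 * ρ * (fderiv ℝ φ p (y - p) - K₁ * ‖y - p‖ ^ 2) := by linarith
    have h7 : 0 < fderiv ℝ φ p (y - p) - K₁ * ‖y - p‖ ^ 2 :=
      (mul_pos_iff_of_pos_left (by positivity)).1 h6
    linarith
  · -- the exterior ball `B_ρ(p - ρν) ∩ Ω = ∅`
    refine ⟨p - ρ • ν, Set.disjoint_left.2 fun y hy hyΩ => ?_, by rw [sub_sub_cancel_left, norm_neg, hρν]⟩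
    have hyc : dist y (p - ρ • ν) < ρ := hy
    have hyb : y ∈ ball x₀ r := hchartball (by rw [sub_sub_cancel_left, norm_neg, hρν]) hyc
    have hφy : 0 < φ y := (hmem y hyb).1 hyΩ
    have hW0 : 0 ≤ ‖y - p‖ ^ 2 := by positivity
    -- `‖(y - p) + ρν‖ < ρ` gives `2ρ ⟪y - p, ν⟫ < -‖y - p‖²`
    have hlt : ‖y - p‖ ^ 2 + 2 * (ρ * (‖N‖⁻¹ * fderiv ℝ φ p (y - p))) + ρ ^ 2 < ρ ^ 2 := by
      have h1 : ‖(y - p) + ρ • ν‖ < ρ := by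
        have e : (y - p) + ρ • ν = y - (p - ρ • ν) := by abel
        rw [e, ← dist_eq_norm]
        exact hyc
      have h2 : ‖(y - p) + ρ • ν‖ ^ 2 < ρ ^ 2 := pow_lt_pow_left₀ h1 (norm_nonneg _) two_ne_zero
      rwa [norm_add_sq_real, hνin, hρν] at h2
    have h1 : 2 * ρ * (‖N‖⁻¹ * fderiv ℝ φ p (y - p)) < -‖y - p‖ ^ 2 := by linarith
    have h2 : 2 * ρ * fderiv ℝ φ p (y - p) < -(‖N‖ * ‖y - p‖ ^ 2) := by
      have := mul_lt_mul_of_pos_left h1 hm0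
      rwa [show ‖N‖ * (2 * ρ * (‖N‖⁻¹ * fderiv ℝ φ p (y - p))) = 2 * ρ * fderiv ℝ φ p (y - p) by
        field_simp, mul_neg] at this
    have h3 : ‖y - p‖ ^ 2 ≤ ‖N‖ * ‖y - p‖ ^ 2 := le_mul_of_one_le_left hW0 hm1
    -- Taylor: `φ y ≤ a + K₁ W`
    have h4 := (abs_le.1 (hTp y hyb)).2
    have h5 : 0 ≤ (1 - ρ * (2 * K₁)) * ‖y - p‖ ^ 2 := mul_nonneg (by linarith) hW0
    have h6 : 2 * ρ * (fderiv ℝ φ p (y - p) + K₁ * ‖y - p‖ ^ 2) < 0 := by linarith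
    have h7 : 0 < 2 * ρ * φ y := by positivity
    have h8 : 2 * ρ * φ y ≤ 2 * ρ * (fderiv ℝ φ p (y - p) + K₁ * ‖y - p‖ ^ 2) :=
      mul_le_mul_of_nonneg_left (by linarith) (by positivity)
    linarith

/-- **Uniform two-sided tangent balls for a bounded `C²` domain**: if `Ω` is bounded with `C²`
boundary (`IsContDiffDomain 2 Ω`), there is `ρ > 0` such that every `p ∈ ∂Ω` admits an interior
tangent ball `B_ρ(c) ⊆ Ω` and an exterior tangent ball `B_ρ(c')`, `B_ρ(c') ∩ Ω = ∅`, with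
`‖c - p‖ = ‖c' - p‖ = ρ` (locally uniform radii by `exists_twoSided_ball_of_isContDiffGraphNear`,
compactness of `∂Ω`) (Han–Shen 2020, §1 and proof of Thm. 3.1: "`B_r(re_n) ⊂ Ω` and
`B_r(-re_n) ∩ Ω = ∅`" with "`M` … chosen to be uniform"). [cite: HanShen2020, proof of Thm. 3.1] -/
theorem exists_uniform_twoSided_ball (Ω : Opens E) (hb : IsBounded (Ω : Set E))
    (hΩ : IsContDiffDomain 2 Ω) :
    ∃ ρ > 0, ∀ p ∈ frontier (Ω : Set E),
      (∃ c, ball c ρ ⊆ (Ω : Set E) ∧ ‖c - p‖ = ρ) ∧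
      (∃ c', Disjoint (ball c' ρ) (Ω : Set E) ∧ ‖c' - p‖ = ρ) := by
  have hloc : ∀ x ∈ frontier (Ω : Set E), ∃ r > (0 : ℝ), ∃ ρ₀ > (0 : ℝ), ∀ ρ, 0 < ρ → ρ ≤ ρ₀ →
      ∀ p ∈ frontier (Ω : Set E) ∩ ball x r,
        (∃ c, ball c ρ ⊆ (Ω : Set E) ∧ ‖c - p‖ = ρ) ∧
        (∃ c', Disjoint (ball c' ρ) (Ω : Set E) ∧ ‖c' - p‖ = ρ) := by
    intro x hx
    obtain ⟨r, hr, h⟩ := hΩ x hx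
    obtain ⟨ρ₀, hρ₀, H⟩ := exists_twoSided_ball_of_isContDiffGraphNear h hr
    exact ⟨r / 2, by positivity, ρ₀, hρ₀, H⟩
  choose! r hr ρ₀ hρ₀ H using hloc
  have hKc : IsCompact (frontier (Ω : Set E)) :=
    Metric.isCompact_of_isClosed_isBounded isClosed_frontier
      (hb.closure.subset frontier_subset_closure)
  obtain ⟨t, ht, htfin, hcover⟩ := hKc.elim_finite_subcover_image (b := frontier (Ω : Set E))
    (c := fun x => ball x (r x)) (fun x _ => isOpen_ball)
    (fun x hx => mem_iUnion₂.2 ⟨x, hx, mem_ball_self (hr x hx)⟩)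
  obtain ⟨ρ, hρ, hρle⟩ := exists_pos_le_of_finite htfin ρ₀ fun x hx => hρ₀ x (ht hx)
  refine ⟨ρ, hρ, fun p hp => ?_⟩
  obtain ⟨x, hxt, hpx⟩ := mem_iUnion₂.1 (hcover hp)
  exact H x (ht hxt) ρ hρ (hρle x hxt) p ⟨hp, hpx⟩

/-! ### F3 discharged: the boundary asymptotics -/

/-- **F3 holds: the Loewner–Nirenberg boundary asymptotics** `|d(x)^{(n-2)/2} u(x) - 1| ≤ C d(x)`
for `d(x) < δ`, for every positive large solution `u` of a bounded `C²` domain `Ω ⊂ ℝⁿ`, `n ≥ 3`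
(Loewner–Nirenberg 1974; Han–Shen 2020, (1.3) and Thm. 3.1 with `α = 1`). The proof is the
published one (Han–Shen 2020, proof of Thm. 3.1, case `α = 1`): with `r` a uniform radius of
two-sided tangent balls (`exists_uniform_twoSided_ball`), `δ = r`, and for `x ∈ Ω` with
`d = d(x) < r` and nearest boundary point `p`, the maximum principle gives
`v_{r,c'}(x) ≤ u(x) ≤ u_{r,c}(x)` for the tangent balls `B_r(c) ⊆ Ω`, `B_r(c') ∩ Ω = ∅` at `p`
(`IsSubsolution.le_ballProfile` on `B̄_σ(c)`, `σ → r`; `exteriorProfile_le_of_isLargeSolution`), where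
`|x - c| = r - d`,
`|x - c'| = r + d` (`norm_sub_center_eq_of_tangent_balls`), i.e.
`(1 + d/2r)^{-k} ≤ d^k u(x) ≤ (1 - d/2r)^{-k}`, `k = (n-2)/2`; finally
`1 - s^k ≤ max(k,1)(1 - s)` on `(0, 1]` yields `|d^k u - 1| ≤ (max(k,1) 2^k / 2r) d`.
[cite: HanShen2020, (1.3) and Thm. 3.1 (LoewnerNirenberg1974)] -/
theorem boundary_asymptotics_holds : boundary_asymptotics (E := E) := by
  intro Ω hn hb _ hΩ u hu _ _
  haveI := nontrivial_of_three_le_finrank hn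
  obtain ⟨ρ, hρ, hballs⟩ := exists_uniform_twoSided_ball Ω hb hΩ
  obtain ⟨k, hk⟩ : ∃ k : ℝ, ((finrank ℝ E : ℝ) - 2) / 2 = k := ⟨_, rfl⟩
  have hk0 : 0 < k := by
    have h3 : (3 : ℝ) ≤ finrank ℝ E := by exact_mod_cast hn
    rw [← hk]
    linarith
  refine ⟨max k 1 / (1 / 2) ^ k / (2 * ρ), ρ, hρ, fun x hx hdρ => ?_⟩
  rw [hk]
  -- the frontier is nonempty and compact; a nearest boundary point `p`; `B_d(x) ⊆ Ω`
  have hfr_ne : (frontier (Ω : Set E)).Nonempty := by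
    rw [nonempty_frontier_iff]
    refine ⟨⟨x, hx⟩, fun h => ?_⟩
    obtain ⟨y, hy⟩ := exists_notMem_closure_of_isBounded hb
    rw [h, closure_univ] at hy
    exact hy (mem_univ _)
  have hfr_c : IsCompact (frontier (Ω : Set E)) :=
    Metric.isCompact_of_isClosed_isBounded isClosed_frontier
      (hb.closure.subset frontier_subset_closure)
  obtain ⟨p, hp, hdp⟩ := hfr_c.exists_infDist_eq_dist hfr_ne x
  have hd0 : 0 < infDist x (frontier (Ω : Set E)) := by
    refine (isClosed_frontier.notMem_iff_infDist_pos hfr_ne).1 fun h => ?_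
    rw [Ω.isOpen.frontier_eq] at h
    exact h.2 hx
  have hxball : ball x (infDist x (frontier (Ω : Set E))) ⊆ (Ω : Set E) :=
    ball_infDist_frontier_subset Ω.isOpen hx
  obtain ⟨d, hd⟩ : ∃ d : ℝ, infDist x (frontier (Ω : Set E)) = d := ⟨_, rfl⟩
  rw [hd] at hdρ hd0 hxball hdp ⊢
  -- the tangent balls at `p`; collinearity
  obtain ⟨⟨c, hcΩ, hcp⟩, ⟨c', hc'Ω, hc'p⟩⟩ := hballs p hp
  have hxp : ‖x - p‖ = d := by rw [← dist_eq_norm]; exact hdp.symm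
  obtain ⟨hxc', hxc⟩ :=
    norm_sub_center_eq_of_tangent_balls hd0 hρ hdρ.le hxball hcΩ hc'Ω hxp hcp hc'p
  -- `v_{ρ,c'}(x) ≤ u(x) ≤ u_{ρ,c}(x)` by the maximum principle
  have hx_in : x ∈ ball c ρ := by
    rw [mem_ball, dist_eq_norm, hxc]
    linarith
  have hup : u x ≤ ballProfile c ρ x := by
    -- `u ≤ u_{σ,c}` on `B_σ(c)` for `‖x - c‖ < σ < ρ` (`B̄_σ(c) ⊆ Ω`; González–Li–Nguyen 2018,
    -- Lemma 3.1, `IsSubsolution.le_ballProfile`), and `u_{σ,c}(x) → u_{ρ,c}(x)` as `σ → ρ`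
    have hxρ : ‖x - c‖ < ρ := by rwa [mem_ball, dist_eq_norm] at hx_in
    have hev : ∀ᶠ σ in 𝓝[<] ρ, u x ≤ ballProfile c σ x := by
      filter_upwards [Ioo_mem_nhdsLT hxρ] with σ hσ
      exact hu.isSubsolution.le_ballProfile hn Ω.isOpen ((norm_nonneg _).trans_lt hσ.1)
        ((closedBall_subset_ball hσ.2).trans hcΩ) x (by rw [mem_ball, dist_eq_norm]; exact hσ.1)
    have hcont : ContinuousAt (fun σ : ℝ => ballProfile c σ x) ρ := by
      have hden : 0 < ρ ^ 2 - ‖x - c‖ ^ 2 := by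
        have : ‖x - c‖ ^ 2 < ρ ^ 2 := pow_lt_pow_left₀ hxρ (norm_nonneg _) two_ne_zero
        linarith
      unfold ballProfile
      refine ContinuousAt.rpow_const ?_ (Or.inl ?_)
      · exact (continuousAt_const.mul continuousAt_id).div
          ((continuousAt_id.pow 2).sub continuousAt_const) hden.ne'
      · exact (div_pos (by linarith) hden).ne'
    exact ge_of_tendsto (hcont.tendsto.mono_left nhdsWithin_le_nhds) hev
  have hlow : exteriorProfile c' ρ x ≤ u x :=
    exteriorProfile_le_of_isLargeSolution hn Ω.isOpen hb hu hρ hc'Ω hx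
  -- the values of the profiles at `x`: `d^k u_{ρ,c}(x) = s₁^{-k}`, `d^k v_{ρ,c'}(x) = s₂^k`
  set s₁ : ℝ := (2 * ρ - d) / (2 * ρ) with hs₁
  set s₂ : ℝ := 2 * ρ / (2 * ρ + d) with hs₂
  have hs₁0 : 0 < s₁ := by rw [hs₁]; exact div_pos (by linarith) (by linarith)
  have hs₁1 : s₁ ≤ 1 := by rw [hs₁, div_le_one (by linarith)]; linarith
  have hs₁h : 1 / 2 ≤ s₁ := by rw [hs₁, le_div_iff₀ (by linarith)]; linarith
  have hs₂0 : 0 < s₂ := by rw [hs₂]; exact div_pos (by linarith) (by linarith)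
  have hs₂1 : s₂ ≤ 1 := by rw [hs₂, div_le_one (by linarith)]; linarith
  have hdne : d ≠ 0 := hd0.ne'
  have hρne : ρ ≠ 0 := hρ.ne'
  have h2ρd : 2 * ρ - d ≠ 0 := by
    intro h
    linarith
  have h2ρd' : 2 * ρ + d ≠ 0 := by
    intro h
    linarith
  have hA : d ^ k * ballProfile c ρ x = (s₁ ^ k)⁻¹ := by
    have hden : ρ ^ 2 - ‖x - c‖ ^ 2 = d * (2 * ρ - d) := by rw [hxc]; ring
    have hbase : 0 ≤ 2 * ρ / (ρ ^ 2 - ‖x - c‖ ^ 2) := by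
      rw [hden]
      exact div_nonneg (by linarith) (mul_nonneg hd0.le (by linarith))
    unfold ballProfile
    rw [hk, ← Real.mul_rpow hd0.le hbase, ← Real.inv_rpow hs₁0.le, hden]
    congr 1
    rw [hs₁]
    field_simp
  have hB : d ^ k * exteriorProfile c' ρ x = s₂ ^ k := by
    have hden : ‖x - c'‖ ^ 2 - ρ ^ 2 = d * (2 * ρ + d) := by rw [hxc']; ring
    have hbase : 0 ≤ 2 * ρ / (‖x - c'‖ ^ 2 - ρ ^ 2) := by
      rw [hden]
      exact div_nonneg (by linarith) (mul_nonneg hd0.le (by linarith))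
    unfold exteriorProfile
    rw [hk, ← Real.mul_rpow hd0.le hbase, hden]
    congr 1
    rw [hs₂]
    field_simp
  -- the elementary estimates
  have hdk : 0 ≤ d ^ k := Real.rpow_nonneg hd0.le _
  have hhalf : 0 < (1 / 2 : ℝ) ^ k := Real.rpow_pos_of_pos (by norm_num) _
  have hhalf1 : (1 / 2 : ℝ) ^ k ≤ 1 := Real.rpow_le_one (by norm_num) (by norm_num) hk0.le
  have hs₁k : (1 / 2 : ℝ) ^ k ≤ s₁ ^ k := Real.rpow_le_rpow (by norm_num) hs₁h hk0.le
  have hs₁k0 : 0 < s₁ ^ k := Real.rpow_pos_of_pos hs₁0 _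
  have hmax0 : 0 ≤ max k 1 := le_trans zero_le_one (le_max_right _ _)
  have hupper : (s₁ ^ k)⁻¹ - 1 ≤ max k 1 / (1 / 2) ^ k / (2 * ρ) * d := by
    have h1 : 1 - s₁ ^ k ≤ max k 1 * (1 - s₁) := one_sub_rpow_le_max_mul k hs₁0 hs₁1
    have h2 : 1 - s₁ = d / (2 * ρ) := by
      rw [hs₁]
      field_simp
      ring
    rw [h2] at h1
    have h3 : (s₁ ^ k)⁻¹ - 1 = (1 - s₁ ^ k) / s₁ ^ k := by
      field_simp
    rw [h3]
    calc (1 - s₁ ^ k) / s₁ ^ k ≤ max k 1 * (d / (2 * ρ)) / (1 / 2) ^ k :=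
          div_le_div₀ (by positivity) h1 hhalf hs₁k
      _ = max k 1 / (1 / 2) ^ k / (2 * ρ) * d := by
          field_simp
  have hlower : 1 - s₂ ^ k ≤ max k 1 / (1 / 2) ^ k / (2 * ρ) * d := by
    have h1 : 1 - s₂ ^ k ≤ max k 1 * (1 - s₂) := one_sub_rpow_le_max_mul k hs₂0 hs₂1
    have h2 : 1 - s₂ = d / (2 * ρ + d) := by
      rw [hs₂]
      field_simp
      ring
    have h3 : d / (2 * ρ + d) ≤ d / (2 * ρ) :=
      div_le_div_of_nonneg_left hd0.le (by positivity) (by linarith)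
    calc 1 - s₂ ^ k ≤ max k 1 * (d / (2 * ρ)) := by
          rw [h2] at h1
          exact h1.trans (mul_le_mul_of_nonneg_left h3 hmax0)
      _ ≤ max k 1 * (d / (2 * ρ)) / (1 / 2) ^ k := le_div_self (by positivity) hhalf hhalf1
      _ = max k 1 / (1 / 2) ^ k / (2 * ρ) * d := by
          field_simp
  -- conclusion
  rw [abs_sub_le_iff]
  constructor
  · calc d ^ k * u x - 1 ≤ d ^ k * ballProfile c ρ x - 1 := by
          linarith [mul_le_mul_of_nonneg_left hup hdk]
      _ = (s₁ ^ k)⁻¹ - 1 := by rw [hA]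
      _ ≤ _ := hupper
  · calc 1 - d ^ k * u x ≤ 1 - d ^ k * exteriorProfile c' ρ x := by
          linarith [mul_le_mul_of_nonneg_left hlow hdk]
      _ = 1 - s₂ ^ k := by rw [hB]
      _ ≤ _ := hlower

end LoewnerNirenberg

end Literature.Analysis.PDE
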